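import Literature.Analysis.FluidPDE.ElgindiRadialMulHk
import Literature.Analysis.FluidPDE.ElgindiEllipticHkTools
import HarnessLib

/-!
# The `𝓗⁴` functional of separable products `g(R)·sin 2θ`
([Elgindi2021] §7.5, the corrector `G(R) sin 2θ` of Theorem 2)

Topic `Literature/Analysis/FluidPDE`. Support file (definitions with bodies and proved theorems, no
named facts) on the proof path of the named fact
`Literature.Analysis.FluidPDE.Elgindi.ElgindiGhoulMasmoudi2021_stabilityCore`
(`ElgindiStabilityDecomposition.lean`). T. M. Elgindi, Ann. of Math. 194 (2021) =
arXiv:1904.04795, §7.5 (p. 24: "`L(G(R) sin(2θ)) = (α²R²∂_{RR}G + α(5+α)R∂_RG) sin(2θ)` … which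
will follow from a bound on `αG`").

For the tensor `g ⊗ sin 2θ` the mixed iterates separate exactly
(`D_θ^iD_R^j(g ⊗ s) = (Dz₁^jg) ⊗ (Dθ₁^is)`), every `Dθ₁^i(sin 2θ)` carries a factor `sin 2θ`, and
the singular angular weights `sin(2θ)^{−η}`, `sin(2θ)^{−γ}` are thereby cancelled; hence
`|g ⊗ sin 2θ|²_{𝓗⁴} ≤ K Σ_{j≤4} ∫_{R>0} w²(Dz₁^jg)²` with a universal `K` (`eHkNormSq_tensor_sin2_le`).
-/

noncomputable section

open MeasureTheory Set Real Filter Function Finset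
open _root_.Topology
open scoped ENNReal ContDiff

namespace Literature.Analysis.FluidPDE

namespace Elgindi

/-! ### The angular factor `sin 2θ` and its `Dθ₁`-iterates -/

/-- `s(θ) = sin 2θ`. [folklore] -/
def sin2 (θ : ℝ) : ℝ := Real.sin (2 * θ)

/-- `Dθ₁^i(sin 2θ) = sin 2θ·P_i(θ)` with `P_i` smooth. [folklore] -/
theorem iterate_Dθ₁_sin2 (i : ℕ) : ∃ P : ℝ → ℝ, ContDiff ℝ ∞ P ∧ Dθ₁^[i] sin2 = fun θ => Real.sin (2 * θ) * P θ := by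
  induction i with
  | zero => exact ⟨fun _ => 1, contDiff_const, by funext θ; simp [sin2]⟩
  | succ i ih =>
    obtain ⟨P, hP, hPe⟩ := ih
    refine ⟨fun θ => 2 * Real.cos (2 * θ) * P θ + Real.sin (2 * θ) * deriv P θ, ?_, ?_⟩
    · exact ((contDiff_const.mul (Real.contDiff_cos.comp (contDiff_const.mul contDiff_id))).mul hP).add
        ((Real.contDiff_sin.comp (contDiff_const.mul contDiff_id)).mul hP.deriv')
    · rw [Function.iterate_succ_apply', hPe]
      funext θ
      rw [Dθ₁_apply]
      have h1 : HasDerivAt (fun θ => Real.sin (2 * θ)) (2 * Real.cos (2 * θ)) θ := by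
        have := ((hasDerivAt_id θ).const_mul 2).sin
        simp only [id] at this
        convert this using 1; ring
      have h2 : HasDerivAt P (deriv P θ) θ := (hP.differentiable (by simp) θ).hasDerivAt
      have h12 : HasDerivAt (fun θ => Real.sin (2 * θ) * P θ) _ θ := h1.mul h2
      rw [h12.deriv]

/-- **`|Dθ₁^i(sin 2θ)| ≤ B_i·sin 2θ` on `(0, π/2)`.** [folklore] -/
theorem abs_iterate_Dθ₁_sin2_le (i : ℕ) : ∃ B : ℝ, 0 ≤ B ∧ ∀ θ ∈ Ioo (0:ℝ) (π / 2), |(Dθ₁^[i] sin2) θ| ≤ B * Real.sin (2 * θ) := by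
  obtain ⟨P, hP, hPe⟩ := iterate_Dθ₁_sin2 i
  obtain ⟨B, hB⟩ := isCompact_Icc.exists_bound_of_continuousOn (hP.continuous.continuousOn (s := Icc (0:ℝ) (π / 2)))
  refine ⟨max B 0, le_max_right _ _, fun θ hθ => ?_⟩
  rw [hPe]
  have hs : 0 < Real.sin (2 * θ) := Real.sin_pos_of_pos_of_lt_pi (by linarith [hθ.1]) (by linarith [hθ.2])
  show |Real.sin (2 * θ) * P θ| ≤ max B 0 * Real.sin (2 * θ)
  rw [abs_mul, abs_of_pos hs, mul_comm]
  refine mul_le_mul_of_nonneg_right ?_ hs.le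
  have := hB θ (Ioo_subset_Icc_self hθ)
  rw [Real.norm_eq_abs] at this
  exact this.trans (le_max_left _ _)

/-! ### Angular weights against `sin 2θ` -/

/-- `sin(2θ)²·sin(2θ)^{−c} ≤ 1` on the strip for `c ≤ 2`. [folklore] -/
theorem sin2_sq_mul_rpow_neg_le {c : ℝ} (hc : c ≤ 2) {θ : ℝ} (hθ : θ ∈ Ioo (0:ℝ) (π / 2)) :
    Real.sin (2 * θ) ^ 2 * Real.sin (2 * θ) ^ (-c) ≤ 1 := by
  have hs : 0 < Real.sin (2 * θ) := Real.sin_pos_of_pos_of_lt_pi (by linarith [hθ.1]) (by linarith [hθ.2])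
  have hs1 : Real.sin (2 * θ) ≤ 1 := Real.sin_le_one _
  rw [← Real.rpow_natCast, ← Real.rpow_add hs]
  push_cast
  exact Real.rpow_le_one hs.le hs1 (by linarith)

/-! ### Product integrals on the strip -/

/-- `∫∫_strip a(R)b(θ) = (∫_{R>0} a)(∫_{(0,π/2)} b)` for a.e.-measurable `ℝ≥0∞`-valued `a, b`. [folklore] -/
theorem lintegral_strip_tensor {a b : ℝ → ℝ≥0∞} (ha : AEMeasurable a (volume.restrict (Ioi 0))) (hb : AEMeasurable b (volume.restrict (Ioo 0 (π / 2)))) :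
    ∫⁻ p in strip, a p.1 * b p.2 = (∫⁻ R in Ioi 0, a R) * ∫⁻ θ in Ioo 0 (π / 2), b θ := by
  have hprod : (volume.restrict strip : Measure (ℝ × ℝ)) = (volume.restrict (Ioi (0:ℝ))).prod (volume.restrict (Ioo 0 (π / 2))) := by
    rw [show strip = Ioi (0:ℝ) ×ˢ Ioo 0 (π / 2) from rfl, Measure.volume_eq_prod, Measure.prod_restrict]
  rw [hprod, lintegral_prod_mul ha hb]

/-- A strip integral of a function of `R` alone: `∫∫_strip ofReal(C·a(R)) = ofReal(C·π/2)·∫_{R>0} ofReal(a)`. [folklore] -/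
theorem lintegral_strip_radial_le {a : ℝ → ℝ} (ha : AEMeasurable a (volume.restrict (Ioi 0))) {C : ℝ} (hC : 0 ≤ C) :
    ∫⁻ p in strip, ENNReal.ofReal (C * a p.1) ≤ ENNReal.ofReal (C * (π / 2)) * ∫⁻ R in Ioi 0, ENNReal.ofReal (a R) := by
  have e : ∀ p : ℝ × ℝ, ENNReal.ofReal (C * a p.1) = (fun R => ENNReal.ofReal C * ENNReal.ofReal (a R)) p.1 * (fun _ : ℝ => (1 : ℝ≥0∞)) p.2 := by
    intro p; simp only [mul_one]; rw [ENNReal.ofReal_mul hC]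
  simp_rw [e]
  rw [lintegral_strip_tensor ((ha.ennreal_ofReal).const_mul _) aemeasurable_const, setLIntegral_const, Real.volume_Ioo, sub_zero,
    lintegral_const_mul'' _ ha.ennreal_ofReal, ENNReal.ofReal_mul hC, one_mul]
  refine le_of_eq ?_
  simp only [mul_comm, mul_assoc, mul_left_comm]

/-! ### The `𝓗⁴` functional of `g ⊗ sin 2θ` -/

/-- The radial energies `A_j(g) = ∫_{R>0} w²(Dz₁^jg)²`. [folklore] -/
def radialEnergy (j : ℕ) (g : ℝ → ℝ) : ℝ≥0∞ := ∫⁻ R in Ioi 0, ENNReal.ofReal (radialWeight R ^ 2 * (Dz₁^[j] g) R ^ 2)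

/-- **`|g ⊗ sin 2θ|²_{𝓗⁴} ≤ K Σ_{j≤4} A_j(g)`** for `g ∈ C⁴(0,∞)`, `0 < α ≤ 1`, with a universal `K`. [cite: Elgindi2021, §7.5 (p. 24 of arXiv:1904.04795)] -/
theorem eHkNormSq_tensor_sin2_le : ∃ K : ℝ, 0 ≤ K ∧ ∀ (α : ℝ), 0 < α → α ≤ 1 → ∀ (g : ℝ → ℝ), ContDiffOn ℝ 4 g (Ioi 0) →
    eHkNormSq α 4 (tensor g sin2) ≤ ENNReal.ofReal K * ∑ j ∈ range 5, radialEnergy j g := by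
  -- the angular constants
  choose B hB0 hB using abs_iterate_Dθ₁_sin2_le
  set Bmax : ℝ := ∑ i ∈ range 5, B i ^ 2 + 1 with hBmax
  have hBle : ∀ i, i ≤ 4 → B i ^ 2 ≤ Bmax := fun i hi => by
    have : B i ^ 2 ≤ ∑ i ∈ range 5, B i ^ 2 := single_le_sum (f := fun i => B i ^ 2) (fun i _ => sq_nonneg _) (mem_range.2 (by omega))
    linarith
  refine ⟨30 * (Bmax * (π / 2)), by positivity, fun α hα hα1 g hg => ?_⟩
  have hγ2 : gammaExp α ≤ 2 := by unfold gammaExp; linarith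
  have hvol : ∫⁻ _θ in Ioo (0:ℝ) (π / 2), (1 : ℝ≥0∞) = ENNReal.ofReal (π / 2) := by
    rw [setLIntegral_const, Real.volume_Ioo, sub_zero, one_mul]
  -- continuity (hence a.e.-measurability) of the radial iterates on `(0,∞)`
  have hcA : ∀ j, j ≤ 4 → AEMeasurable (fun R : ℝ => radialWeight R ^ 2 * (Dz₁^[j] g) R ^ 2) (volume.restrict (Ioi 0)) := by
    intro j hj
    have h1 : ContinuousOn (fun R : ℝ => radialWeight R ^ 2) (Ioi 0) := by
      unfold radialWeight
      exact ContinuousOn.pow (ContinuousOn.div (by fun_prop) (by fun_prop) fun R hR => pow_ne_zero 2 (ne_of_gt hR)) 2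
    have h2 : ContinuousOn (Dz₁^[j] g) (Ioi 0) := (contDiffOn_iterate_Dz₁_Ioi (N := 4) hg (l := j) (m := 0) (by omega)).continuousOn
    exact (h1.mul (h2.pow 2)).aemeasurable measurableSet_Ioi
  -- the common radial bound
  have hrad : ∀ j, j ≤ 4 → ∀ {G : ℝ × ℝ → ℝ}, (∀ p ∈ strip, G p ^ 2 ≤ Bmax * (radialWeight p.1 ^ 2 * (Dz₁^[j] g) p.1 ^ 2)) →
      ∫⁻ p in strip, ENNReal.ofReal (G p ^ 2) ≤ ENNReal.ofReal (Bmax * (π / 2)) * ∑ j ∈ range 5, radialEnergy j g := by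
    intro j hj G hG
    calc ∫⁻ p in strip, ENNReal.ofReal (G p ^ 2)
        ≤ ∫⁻ p in strip, ENNReal.ofReal (Bmax * (radialWeight p.1 ^ 2 * (Dz₁^[j] g) p.1 ^ 2)) :=
          setLIntegral_mono' measurableSet_strip fun p hp => ENNReal.ofReal_le_ofReal (hG p hp)
      _ ≤ ENNReal.ofReal (Bmax * (π / 2)) * ∫⁻ R in Ioi 0, ENNReal.ofReal (radialWeight R ^ 2 * (Dz₁^[j] g) R ^ 2) :=
          lintegral_strip_radial_le (hcA j hj) (by positivity)
      _ ≤ ENNReal.ofReal (Bmax * (π / 2)) * ∑ j ∈ range 5, radialEnergy j g := by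
          refine mul_le_mul_right ?_ _
          exact single_le_sum (f := fun j => radialEnergy j g) (fun _ _ => bot_le) (mem_range.2 (by omega))
  have h1B : 1 ≤ Bmax := by
    have : 0 ≤ ∑ i ∈ range 5, B i ^ 2 := sum_nonneg fun _ _ => sq_nonneg _
    linarith
  have hB' := eHkNormSq_le_of_forall_le (α := α) (k := 4) (f := tensor g sin2) (B := ENNReal.ofReal (Bmax * (π / 2)) * ∑ j ∈ range 5, radialEnergy j g)
    (fun j hj => by
      rw [eL2Sq_eq_lintegral_ofReal]
      refine hrad j hj (G := fun p => hkRadialTerm j (tensor g sin2) p.1 p.2) fun p hp => ?_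
      show (hkRadialTerm j (tensor g sin2) p.1 p.2) ^ 2 ≤ _
      rw [sq_hkRadialTerm j _ hp, iterate_Dz_tensor]
      simp only [tensor_apply, sin2]
      have hw0 : 0 ≤ radialWeight p.1 ^ 2 * (Dz₁^[j] g) p.1 ^ 2 := by positivity
      have hs := sin2_sq_mul_rpow_neg_le (c := eta) (by unfold eta; norm_num) hp.2
      calc radialWeight p.1 ^ 2 * ((Dz₁^[j] g) p.1 * Real.sin (2 * p.2)) ^ 2 * Real.sin (2 * p.2) ^ (-eta)
          = (radialWeight p.1 ^ 2 * (Dz₁^[j] g) p.1 ^ 2) * (Real.sin (2 * p.2) ^ 2 * Real.sin (2 * p.2) ^ (-eta)) := by ring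
        _ ≤ (radialWeight p.1 ^ 2 * (Dz₁^[j] g) p.1 ^ 2) * 1 := mul_le_mul_of_nonneg_left hs hw0
        _ ≤ Bmax * (radialWeight p.1 ^ 2 * (Dz₁^[j] g) p.1 ^ 2) := by nlinarith)
    (fun i j hi hij => by
      rw [eL2Sq_eq_lintegral_ofReal]
      refine hrad j (by omega) (G := fun p => hkMixedTerm α i j (tensor g sin2) p.1 p.2) fun p hp => ?_
      show (hkMixedTerm α i j (tensor g sin2) p.1 p.2) ^ 2 ≤ _
      rw [sq_hkMixedTerm α i j _ hp, iterate_Dθ_Dz_tensor]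
      simp only [tensor_apply]
      have hw0 : 0 ≤ radialWeight p.1 ^ 2 * (Dz₁^[j] g) p.1 ^ 2 := by positivity
      have hs := sin2_sq_mul_rpow_neg_le (c := gammaExp α) hγ2 hp.2
      have hD := hB i p.2 hp.2
      have hγp : 0 ≤ Real.sin (2 * p.2) ^ (-gammaExp α) :=
        Real.rpow_nonneg (Real.sin_pos_of_pos_of_lt_pi (by linarith [hp.2.1]) (by linarith [hp.2.2])).le _
      have hD2 : (Dθ₁^[i] sin2) p.2 ^ 2 ≤ B i ^ 2 * Real.sin (2 * p.2) ^ 2 := by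
        rw [← sq_abs, ← mul_pow]; exact pow_le_pow_left₀ (abs_nonneg _) hD 2
      calc radialWeight p.1 ^ 2 * ((Dz₁^[j] g) p.1 * (Dθ₁^[i] sin2) p.2) ^ 2 * Real.sin (2 * p.2) ^ (-gammaExp α)
          = (radialWeight p.1 ^ 2 * (Dz₁^[j] g) p.1 ^ 2) * ((Dθ₁^[i] sin2) p.2 ^ 2 * Real.sin (2 * p.2) ^ (-gammaExp α)) := by ring
        _ ≤ (radialWeight p.1 ^ 2 * (Dz₁^[j] g) p.1 ^ 2) * (B i ^ 2 * (Real.sin (2 * p.2) ^ 2 * Real.sin (2 * p.2) ^ (-gammaExp α))) := by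
            refine mul_le_mul_of_nonneg_left ?_ hw0
            calc (Dθ₁^[i] sin2) p.2 ^ 2 * Real.sin (2 * p.2) ^ (-gammaExp α)
                ≤ (B i ^ 2 * Real.sin (2 * p.2) ^ 2) * Real.sin (2 * p.2) ^ (-gammaExp α) := mul_le_mul_of_nonneg_right hD2 hγp
              _ = B i ^ 2 * (Real.sin (2 * p.2) ^ 2 * Real.sin (2 * p.2) ^ (-gammaExp α)) := by ring
        _ ≤ (radialWeight p.1 ^ 2 * (Dz₁^[j] g) p.1 ^ 2) * (B i ^ 2 * 1) := by gcongr
        _ ≤ Bmax * (radialWeight p.1 ^ 2 * (Dz₁^[j] g) p.1 ^ 2) := by nlinarith [hBle i (by omega)])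
  refine hB'.trans (le_of_eq ?_)
  rw [show (((4 + 1) + (4 + 1) ^ 2 : ℕ) : ℝ≥0∞) = ENNReal.ofReal 30 by norm_num, ← mul_assoc, ← ENNReal.ofReal_mul (by norm_num)]

end Elgindi

end Literature.Analysis.FluidPDE
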